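import Mathlib
import HarnessLib
import Summits.HubbardSuperconductivity.HubbardSuperconductivity.Theorems.KLProgrammeKLRegimeEngineTowerBlockIncrWtFull
import Summits.HubbardSuperconductivity.HubbardSuperconductivity.Theorems.KLProgrammeKLRegimeEngineTowerDoorToKitPrescribed
import Summits.HubbardSuperconductivity.HubbardSuperconductivity.Theorems.KLProgrammeKLRegimeEngineTowerBlockIncrWtKitUnits

/-!
# Route `KLProgramme` — crux K3 ENGINE (stmt-HubbardSuperconductivity-20437 `KLRegimeEngineV17F2`), stub (b) v2, THE LEVELS PACKAGE (ℓ):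
# instantiation (I1), THE COMPOSED «MODEL Hstep IN KIT FORM» ON THE WEIGHTED ALL-KNOWN TRACK — the born array `klTowerBornWtFull` bounded by the KIT's step right side
# (E1-LEVELS-BLUEPRINT-g8 §3 (I1)/§8/§9; the top-track twin of k3c3-p2 g13's `…TowerBlockIncrWtKit` / `…KitCarrier`; cell gate-hubbard-kl, seat hubbard-kl-k3c2-p3 g12 as
#  SUBSTITUTE typer while the E1 lineage is unseated — E1 / the kit-dictionary lane may rename or supersede)

`klTowerBornWtFull_le_of_blockConsts` (…TowerBlockIncrWtFull, p639666) bounds the weighted all-known born array of block `k` in degree `2(q+1)` by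
`ε^{2q+1}·(cr·cc^{2q+1}·[PRESCRIBED graded bracket + tail] + cr·cc^{2q+1}·[pin-free binomial-prescribed sum])` in the doors' index algebra.  The prescribed
dictionary (…TowerDoorToKitPrescribed: `doorGradedPrescribed_le_kitStep`, `doorBinomialPrescribed_le_towerFO`, `normV_prescribed_le_towerV`) dominates both brackets by
the kit's step terms for ANY track-blind majorant `N` of the weighted prescribed input sizes (`27^c·ε·B m′ c ≤ N m′`, `N 0 = 0`) and any kit parameters `τ ≥ (e³κ)² ⊔ (e²(κ+ρ))²`,
`ψ ≥ κ⁻² ⊔ ρ⁻²`, under the KIT guard `(eα/κ²)·towerV D τ N < 1` (which implies the door's `θ < 1`):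

* **`klTowerBornWtFull_le_kit`** — `klTowerBornWtFull … d k (2(q+1)) ≤ ε^{2q+1}·(cr·cc^{2q+1}·(Σ_{n∈Icc 2 (N₀−1)} e·Φ^{n−1}·ψ^{q+1}·towerS D τ N n (q+1) + ψ^{q+1}·tail(towerV D τ N))
  + cr·cc^{2q+1}·((e²)^{q+2}/2 · towerFO D κ² N (q+1)))` — every binder of p639666 except that the door guard `hθ` is replaced by the kit guard, plus `N`, `D`, `τ`, `ψ`;
* **`klTowerBornWtFull_le_kit'`** — the same in the kit's literal shape `ε^{2q+1}·cr′·cc′^{2q+1}·(towerFO + Σ + tail)` with `cr′ := (e⁴/2)·cr`, `cc′ := e²·cc`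
  (the prescribed first-order constant `(e²)^{q+2}/2` rides with the output-overlap constants, as the kit's `c₂`-type constants do);
* **`klTowerBornWtFull_le_kit_units`** — the same divided by ANY output unit `(u, Kc)` for a track-blind majorant in the kit's product form `N m = (ε·Kc)·(u^m·μ m)`
  (k3c3-p2 g13's `kitStep_abs_eq_units_mul`, …BlockIncrWtKitUnits): `≤ (ε·cr′)·(ε·cc′)^{2q+1}·(u^{q+1}·Kc)·[towerFO D (κ²u) μ (q+1) + Σ e·Φ̂^{n−1}·ψ̂^{q+1}·towerS D (τu) μ n (q+1)
  + ψ̂^{q+1}·e·V̂·(Φ̂V̂)^{N₀−1}/(1−Φ̂V̂)]`, `Φ̂ = (eα/κ²)·(ε·Kc)`, `ψ̂ = ψ/u`, `V̂ = towerV D (τu) μ` — i.e. the `hstep` of `towerBorn_le_law_tracks` for the top track's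
  born array `klTowerBornWtFull … (2p)/((ε·cr′)(ε·cc′)^{2p−1}u^p Kc)` at `(σ, τ, Φ, ψ) := (κ²u, τu, Φ̂, ψ̂)`, modulo the instantiator's choice of `μ` (the units convention is E1's).  Compositions of landed theorems;
nothing about the model is asserted beyond them; nothing asserts (ℓ), any stub, K3 or superconductivity.
References: BGM 2006 §2.7 (2.71a), §2.8 (2.77), (2.81)–(2.84), §3 (3.2)–(3.8) [cite: BenfattoGiulianiMastropietro2006].
-/

noncomputable section

namespace Summit.HubbardSuperconductivity.HubbardSuperconductivity.Theorems.EngineV8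

set_option linter.dupNamespace false -- summit = problem name (single-conjunct summit), D-0017

open Real Finset Literature.MathematicalPhysics.QuantumLattice Literature.Probability.LatticeModels GrassmannAlgebra
open Summit.HubbardSuperconductivity.HubbardSuperconductivity.Theorems.KLProgrammeLegKernels
open Summit.HubbardSuperconductivity.HubbardSuperconductivity.Theorems.KLRegimeSplit
open Summit.HubbardSuperconductivity.HubbardSuperconductivity.Theorems.KLRegimeWick
open Summit.HubbardSuperconductivity.HubbardSuperconductivity.Theorems.TwoPointAssembly
open Literature.Probability.LatticeModels.BattleFederbush
open scoped Nat

variable {L M : ℕ} [NeZero L] [NeZero M]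

/-- **THE WEIGHTED ALL-KNOWN BORN ARRAY IN KIT FORM (prescribed first-order constant explicit).**  Binders: those of `klTowerBornWtFull_le_of_blockConsts` (`1 ≤ d`, `1 ≤ k`,
`Z^K_{Λ_{dk}} ≠ 0`, Gram `κ`, weighted prescribed input sizes `B`, weighted `α`, `ρ`, weighted `(cr, cc)`, `N₀ ≥ 2`) WITHOUT the door guard, plus a track-blind majorant
`N ≥ 0`, `N 0 = 0`, `27^c·ε·B m′ c ≤ N m′`, a degree cap `D`, kit parameters `τ, ψ` dominating `(e³κ)², (e²(κ+ρ))²` resp. `κ⁻², ρ⁻²`, and the KIT guard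
`(eα/κ²)·towerV D τ N < 1`. -/
theorem klTowerBornWtFull_le_kit {β : ℝ} (hβ : 0 < β) (U μ : ℝ) (K : TrigPolyC4v) {d k : ℕ} (hd : 1 ≤ d) (hk : 1 ≤ k)
    (hZ : hubbardEffPartitionFnCT L M β U μ 0 K (klScale klE0 (d * k)) ≠ 0)
    {κ : ℝ} (hκ : 0 < κ)
    (hGB : IsGramBoundedR ((sectorSubMatrix L M β (bgmFatMultiplier L M klE0 β (nambuXiCT L μ K) (d * k - 1))).transpose *
      hubbardCovSliceCT L M β μ 0 K (klScale klE0 (d * (k + 1))) (klScale klE0 (d * k)) *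
        sectorSubMatrix L M β (bgmFatMultiplier L M klE0 β (nambuXiCT L μ K) (d * k - 1))) κ)
    (B : ℕ → ℕ → ℝ) (hB0 : ∀ m' Fc, 0 ≤ B m' Fc)
    (hB : ∀ (m' Fc : ℕ) (E : Finset (Fin (2 * m' + 1 + 1))) (τ : Fin (2 * m' + 1 + 1) → SectorLeg (sectorCount (d * k - 1)))
      (q : Fin (2 * m' + 1 + 1)), q ∈ E → E.card = Fc + 1 → ∀ y : SpaceTimeIdx L M,
        imagTimeWeight β M ^ (2 * m' + 1) *
          ∑ σ ∈ univ.filter (fun σ : Fin (2 * m' + 1 + 1) → SectorLeg (sectorCount (d * k - 1)) => ∀ e ∈ E, σ e = τ e),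
            ∑ x ∈ univ.filter (fun x : Fin (2 * m' + 1 + 1) → SpaceTimeIdx L M => x q = y),
              klScaleWt L M β (d * k) ((univ.image fun i => (x i, σ i)).image (latticeLegPos (2 * (2 * M)))) *
                ‖sectorisedKernel L M β (klAnisoFamily L M β μ K klE0 (d * k - 1)) (klTowerInput L M β U μ K d k) (2 * m' + 1 + 1) σ x‖ ≤
          B (m' + 1) Fc)
    {α : ℝ} (hα : 0 < α)
    (hrow : ∀ X, ∑ Y, ‖((sectorSubMatrix L M β (bgmFatMultiplier L M klE0 β (nambuXiCT L μ K) (d * k - 1))).transpose *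
        hubbardCovSliceCT L M β μ 0 K (klScale klE0 (d * (k + 1))) (klScale klE0 (d * k)) *
          sectorSubMatrix L M β (bgmFatMultiplier L M klE0 β (nambuXiCT L μ K) (d * k - 1))) X Y‖ *
        klScaleWt L M β (d * k) {latticeLegPos (2 * (2 * M)) X, latticeLegPos (2 * (2 * M)) Y} ≤ α)
    (hcol : ∀ Y, ∑ X, ‖((sectorSubMatrix L M β (bgmFatMultiplier L M klE0 β (nambuXiCT L μ K) (d * k - 1))).transpose *
        hubbardCovSliceCT L M β μ 0 K (klScale klE0 (d * (k + 1))) (klScale klE0 (d * k)) *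
          sectorSubMatrix L M β (bgmFatMultiplier L M klE0 β (nambuXiCT L μ K) (d * k - 1))) X Y‖ *
        klScaleWt L M β (d * k) {latticeLegPos (2 * (2 * M)) X, latticeLegPos (2 * (2 * M)) Y} ≤ α)
    {ρ : ℝ} (hρ : 0 < ρ)
    {cr cc : ℝ} (hcr0 : 0 ≤ cr) (hcc0 : 0 ≤ cc)
    (hrow' : ∀ X'', ∑ X', ‖(sectorAnalysisMatrix L M β (klAnisoFamily L M β μ K klE0 (d * k)) *
        sectorSubMatrix L M β (bgmFatMultiplier L M klE0 β (nambuXiCT L μ K) (d * k - 1))) X'' X'‖ *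
        klScaleWt L M β (d * k) {latticeLegPos (2 * (2 * M)) X'', latticeLegPos (2 * (2 * M)) X'} ≤ cr)
    (hcol' : ∀ X', ∑ X'', ‖(sectorAnalysisMatrix L M β (klAnisoFamily L M β μ K klE0 (d * k)) *
        sectorSubMatrix L M β (bgmFatMultiplier L M klE0 β (nambuXiCT L μ K) (d * k - 1))) X'' X'‖ *
        klScaleWt L M β (d * k) {latticeLegPos (2 * (2 * M)) X'', latticeLegPos (2 * (2 * M)) X'} ≤ cc)
    {N₀ : ℕ} (hN₀ : 2 ≤ N₀)
    {N : ℕ → ℝ} (hN0 : ∀ m, 0 ≤ N m) (hN00 : N 0 = 0) (hNB : ∀ m c, (27 : ℝ) ^ c * (imagTimeWeight β M * B m c) ≤ N m)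
    {D : ℕ} (hD : Fintype.card (SpaceTimeIdx L M × SectorLeg (sectorCount (d * k - 1))) / 2 ≤ D)
    {τ ψ : ℝ} (hτ1 : (exp 3 * κ) ^ 2 ≤ τ) (hτ2 : (exp 2 * (κ + ρ)) ^ 2 ≤ τ) (hψ1 : κ⁻¹ ^ 2 ≤ ψ) (hψ2 : ρ⁻¹ ^ 2 ≤ ψ)
    (hguard : exp 1 * α / κ ^ 2 * towerV D τ N < 1) (q : ℕ) :
    klTowerBornWtFull L M β U μ K d k (2 * (q + 1)) ≤
      imagTimeWeight β M ^ (2 * q + 1) *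
        (cr * cc ^ (2 * q + 1) *
            (∑ n ∈ Icc 2 (N₀ - 1), exp 1 * (exp 1 * α / κ ^ 2) ^ (n - 1) * ψ ^ (q + 1) * towerS D τ N n (q + 1) +
              ψ ^ (q + 1) * (exp 1 * towerV D τ N * (exp 1 * α / κ ^ 2 * towerV D τ N) ^ (N₀ - 1) / (1 - exp 1 * α / κ ^ 2 * towerV D τ N))) +
          cr * cc ^ (2 * q + 1) * (exp 2 ^ (q + 2) / 2 * towerFO D (κ ^ 2) N (q + 1))) := by
  have hε : 0 ≤ imagTimeWeight β M := imagTimeWeight_nonneg hβ.le M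
  have h27 : (0 : ℝ) ≤ 27 := by norm_num
  -- the door guard from the kit guard
  have hV := normV_prescribed_le_towerV (Γ := SpaceTimeIdx L M × SectorLeg (sectorCount (d * k - 1))) (ρc := (27 : ℝ)) (ε := imagTimeWeight β M)
    hκ.le hρ.le (B := B) hN0 hN00 hNB hD hτ2
  have hθ : Real.exp 1 * α * normV (SpaceTimeIdx L M × SectorLeg (sectorCount (d * k - 1))) κ ρ
      (fun m' => (27 : ℝ) ^ 0 * (imagTimeWeight β M * B m' 0)) / κ ^ 2 < 1 := by
    have hΦ0 : 0 ≤ exp 1 * α / κ ^ 2 := by positivity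
    calc Real.exp 1 * α * normV (SpaceTimeIdx L M × SectorLeg (sectorCount (d * k - 1))) κ ρ
          (fun m' => (27 : ℝ) ^ 0 * (imagTimeWeight β M * B m' 0)) / κ ^ 2
        = exp 1 * α / κ ^ 2 * normV (SpaceTimeIdx L M × SectorLeg (sectorCount (d * k - 1))) κ ρ
          (fun m' => (27 : ℝ) ^ 0 * (imagTimeWeight β M * B m' 0)) := by ring
      _ ≤ exp 1 * α / κ ^ 2 * towerV D τ N := mul_le_mul_of_nonneg_left hV hΦ0
      _ < 1 := hguard
  have hmain := klTowerBornWtFull_le_of_blockConsts (L := L) (M := M) hβ U μ K hd hk hZ hκ hGB B hB0 hB hα hrow hcol hρ hθ hcr0 hcc0 hrow' hcol' hN₀ q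
  have hgr := doorGradedPrescribed_le_kitStep (Γ := SpaceTimeIdx L M × SectorLeg (sectorCount (d * k - 1))) (Jt := Fin (2 * q + 1))
    hκ hρ hα.le h27 hε hB0 hN0 hN00 hNB hD hN₀ (m := 2 * q + 1) (p := q + 1) (by ring) hτ1 hτ2 hψ1 hψ2 hguard
  simp only [Fintype.card_fin] at hgr
  have hfo := doorBinomialPrescribed_le_towerFO (κ := κ) (ρc := (27 : ℝ)) (ε := imagTimeWeight β M) hκ.le h27 hε hB0 (N := N) hNB hD q
  refine hmain.trans (mul_le_mul_of_nonneg_left (add_le_add (mul_le_mul_of_nonneg_left hgr (by positivity))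
    (mul_le_mul_of_nonneg_left hfo (by positivity))) (pow_nonneg hε _))

/-- **THE SAME IN THE KIT'S LITERAL SHAPE** `ε^{2q+1}·cr′·cc′^{2q+1}·(towerFO D κ² N (q+1) + Σ_{n∈Icc 2 (N₀−1)} e·Φ^{n−1}·ψ^{q+1}·towerS D τ N n (q+1) + ψ^{q+1}·tail)` with
`cr′ := (e⁴/2)·cr`, `cc′ := e²·cc` (`(e⁴/2)·(e²)^{2q+1} = (e²)^{2q+3}/2 ≥ (e²)^{q+2}/2` and `≥ 1`). -/
theorem klTowerBornWtFull_le_kit' {β : ℝ} (hβ : 0 < β) (U μ : ℝ) (K : TrigPolyC4v) {d k : ℕ} (hd : 1 ≤ d) (hk : 1 ≤ k)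
    (hZ : hubbardEffPartitionFnCT L M β U μ 0 K (klScale klE0 (d * k)) ≠ 0)
    {κ : ℝ} (hκ : 0 < κ)
    (hGB : IsGramBoundedR ((sectorSubMatrix L M β (bgmFatMultiplier L M klE0 β (nambuXiCT L μ K) (d * k - 1))).transpose *
      hubbardCovSliceCT L M β μ 0 K (klScale klE0 (d * (k + 1))) (klScale klE0 (d * k)) *
        sectorSubMatrix L M β (bgmFatMultiplier L M klE0 β (nambuXiCT L μ K) (d * k - 1))) κ)
    (B : ℕ → ℕ → ℝ) (hB0 : ∀ m' Fc, 0 ≤ B m' Fc)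
    (hB : ∀ (m' Fc : ℕ) (E : Finset (Fin (2 * m' + 1 + 1))) (τ : Fin (2 * m' + 1 + 1) → SectorLeg (sectorCount (d * k - 1)))
      (q : Fin (2 * m' + 1 + 1)), q ∈ E → E.card = Fc + 1 → ∀ y : SpaceTimeIdx L M,
        imagTimeWeight β M ^ (2 * m' + 1) *
          ∑ σ ∈ univ.filter (fun σ : Fin (2 * m' + 1 + 1) → SectorLeg (sectorCount (d * k - 1)) => ∀ e ∈ E, σ e = τ e),
            ∑ x ∈ univ.filter (fun x : Fin (2 * m' + 1 + 1) → SpaceTimeIdx L M => x q = y),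
              klScaleWt L M β (d * k) ((univ.image fun i => (x i, σ i)).image (latticeLegPos (2 * (2 * M)))) *
                ‖sectorisedKernel L M β (klAnisoFamily L M β μ K klE0 (d * k - 1)) (klTowerInput L M β U μ K d k) (2 * m' + 1 + 1) σ x‖ ≤
          B (m' + 1) Fc)
    {α : ℝ} (hα : 0 < α)
    (hrow : ∀ X, ∑ Y, ‖((sectorSubMatrix L M β (bgmFatMultiplier L M klE0 β (nambuXiCT L μ K) (d * k - 1))).transpose *
        hubbardCovSliceCT L M β μ 0 K (klScale klE0 (d * (k + 1))) (klScale klE0 (d * k)) *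
          sectorSubMatrix L M β (bgmFatMultiplier L M klE0 β (nambuXiCT L μ K) (d * k - 1))) X Y‖ *
        klScaleWt L M β (d * k) {latticeLegPos (2 * (2 * M)) X, latticeLegPos (2 * (2 * M)) Y} ≤ α)
    (hcol : ∀ Y, ∑ X, ‖((sectorSubMatrix L M β (bgmFatMultiplier L M klE0 β (nambuXiCT L μ K) (d * k - 1))).transpose *
        hubbardCovSliceCT L M β μ 0 K (klScale klE0 (d * (k + 1))) (klScale klE0 (d * k)) *
          sectorSubMatrix L M β (bgmFatMultiplier L M klE0 β (nambuXiCT L μ K) (d * k - 1))) X Y‖ *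
        klScaleWt L M β (d * k) {latticeLegPos (2 * (2 * M)) X, latticeLegPos (2 * (2 * M)) Y} ≤ α)
    {ρ : ℝ} (hρ : 0 < ρ)
    {cr cc : ℝ} (hcr0 : 0 ≤ cr) (hcc0 : 0 ≤ cc)
    (hrow' : ∀ X'', ∑ X', ‖(sectorAnalysisMatrix L M β (klAnisoFamily L M β μ K klE0 (d * k)) *
        sectorSubMatrix L M β (bgmFatMultiplier L M klE0 β (nambuXiCT L μ K) (d * k - 1))) X'' X'‖ *
        klScaleWt L M β (d * k) {latticeLegPos (2 * (2 * M)) X'', latticeLegPos (2 * (2 * M)) X'} ≤ cr)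
    (hcol' : ∀ X', ∑ X'', ‖(sectorAnalysisMatrix L M β (klAnisoFamily L M β μ K klE0 (d * k)) *
        sectorSubMatrix L M β (bgmFatMultiplier L M klE0 β (nambuXiCT L μ K) (d * k - 1))) X'' X'‖ *
        klScaleWt L M β (d * k) {latticeLegPos (2 * (2 * M)) X'', latticeLegPos (2 * (2 * M)) X'} ≤ cc)
    {N₀ : ℕ} (hN₀ : 2 ≤ N₀)
    {N : ℕ → ℝ} (hN0 : ∀ m, 0 ≤ N m) (hN00 : N 0 = 0) (hNB : ∀ m c, (27 : ℝ) ^ c * (imagTimeWeight β M * B m c) ≤ N m)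
    {D : ℕ} (hD : Fintype.card (SpaceTimeIdx L M × SectorLeg (sectorCount (d * k - 1))) / 2 ≤ D)
    {τ ψ : ℝ} (hτ1 : (exp 3 * κ) ^ 2 ≤ τ) (hτ2 : (exp 2 * (κ + ρ)) ^ 2 ≤ τ) (hψ1 : κ⁻¹ ^ 2 ≤ ψ) (hψ2 : ρ⁻¹ ^ 2 ≤ ψ)
    (hguard : exp 1 * α / κ ^ 2 * towerV D τ N < 1) (q : ℕ) :
    klTowerBornWtFull L M β U μ K d k (2 * (q + 1)) ≤
      imagTimeWeight β M ^ (2 * q + 1) *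
        ((exp 4 / 2 * cr) * (exp 2 * cc) ^ (2 * q + 1) *
          (towerFO D (κ ^ 2) N (q + 1) +
            ∑ n ∈ Icc 2 (N₀ - 1), exp 1 * (exp 1 * α / κ ^ 2) ^ (n - 1) * ψ ^ (q + 1) * towerS D τ N n (q + 1) +
            ψ ^ (q + 1) * (exp 1 * towerV D τ N * (exp 1 * α / κ ^ 2 * towerV D τ N) ^ (N₀ - 1) / (1 - exp 1 * α / κ ^ 2 * towerV D τ N)))) := by
  have hε : 0 ≤ imagTimeWeight β M := imagTimeWeight_nonneg hβ.le M
  have hmain := klTowerBornWtFull_le_kit (L := L) (M := M) hβ U μ K hd hk hZ hκ hGB B hB0 hB hα hrow hcol hρ hcr0 hcc0 hrow' hcol' hN₀ hN0 hN00 hNB hD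
    hτ1 hτ2 hψ1 hψ2 hguard q
  refine hmain.trans (mul_le_mul_of_nonneg_left ?_ (pow_nonneg hε _))
  -- abbreviations for the three kit terms
  set FO := towerFO D (κ ^ 2) N (q + 1) with hFO
  set S := ∑ n ∈ Icc 2 (N₀ - 1), exp 1 * (exp 1 * α / κ ^ 2) ^ (n - 1) * ψ ^ (q + 1) * towerS D τ N n (q + 1) with hS
  set T := ψ ^ (q + 1) * (exp 1 * towerV D τ N * (exp 1 * α / κ ^ 2 * towerV D τ N) ^ (N₀ - 1) / (1 - exp 1 * α / κ ^ 2 * towerV D τ N))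
    with hT
  have hτ0 : 0 ≤ τ := le_trans (by positivity) hτ1
  have hψ0 : 0 ≤ ψ := le_trans (by positivity) hψ1
  have hΦ0 : 0 ≤ exp 1 * α / κ ^ 2 := by positivity
  have hFO0 : 0 ≤ FO := towerFO_nonneg (by positivity) hN0 _
  have hS0 : 0 ≤ S := sum_nonneg fun n _ => by
    have := towerS_nonneg (D := D) hτ0 hN0 n (q + 1); positivity
  have hT0 : 0 ≤ T := by
    have hV := towerV_nonneg (D := D) hτ0 hN0
    exact mul_nonneg (pow_nonneg hψ0 _) (div_nonneg (by positivity) (sub_nonneg.2 hguard.le))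
  -- the two constant comparisons
  have he1 : (1 : ℝ) ≤ exp 1 := Real.one_le_exp (by norm_num)
  have he2 : (1 : ℝ) ≤ exp 2 := Real.one_le_exp (by norm_num)
  have hc1 : cr * cc ^ (2 * q + 1) ≤ (exp 4 / 2 * cr) * (exp 2 * cc) ^ (2 * q + 1) := by
    rw [mul_pow]
    have h4 : (2 : ℝ) ≤ exp 4 := by
      have := Real.add_one_le_exp (4 : ℝ); linarith
    have hp : (1 : ℝ) ≤ exp 2 ^ (2 * q + 1) := one_le_pow₀ he2
    have hcc : 0 ≤ cc ^ (2 * q + 1) := pow_nonneg hcc0 _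
    calc cr * cc ^ (2 * q + 1) = 1 * cr * (1 * cc ^ (2 * q + 1)) := by ring
      _ ≤ (exp 4 / 2) * cr * (exp 2 ^ (2 * q + 1) * cc ^ (2 * q + 1)) := by
          gcongr
          · linarith
  have hc2 : cr * cc ^ (2 * q + 1) * (exp 2 ^ (q + 2) / 2) ≤ (exp 4 / 2 * cr) * (exp 2 * cc) ^ (2 * q + 1) := by
    rw [mul_pow]
    have hcc : 0 ≤ cc ^ (2 * q + 1) := pow_nonneg hcc0 _
    have hpow : exp 2 ^ (q + 2) ≤ exp 4 * exp 2 ^ (2 * q + 1) := by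
      have h4 : exp 4 = exp 2 ^ 2 := by rw [← Real.exp_nat_mul]; norm_num
      rw [h4, ← pow_add]
      exact pow_le_pow_right₀ he2 (by omega)
    calc cr * cc ^ (2 * q + 1) * (exp 2 ^ (q + 2) / 2) = (exp 2 ^ (q + 2)) / 2 * cr * cc ^ (2 * q + 1) := by ring
      _ ≤ (exp 4 * exp 2 ^ (2 * q + 1)) / 2 * cr * cc ^ (2 * q + 1) := by gcongr
      _ = exp 4 / 2 * cr * (exp 2 ^ (2 * q + 1) * cc ^ (2 * q + 1)) := by ring
  calc cr * cc ^ (2 * q + 1) * (S + T) + cr * cc ^ (2 * q + 1) * (exp 2 ^ (q + 2) / 2 * FO)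
      = cr * cc ^ (2 * q + 1) * (S + T) + cr * cc ^ (2 * q + 1) * (exp 2 ^ (q + 2) / 2) * FO := by ring
    _ ≤ (exp 4 / 2 * cr) * (exp 2 * cc) ^ (2 * q + 1) * (S + T) + (exp 4 / 2 * cr) * (exp 2 * cc) ^ (2 * q + 1) * FO :=
        add_le_add (mul_le_mul_of_nonneg_right hc1 (add_nonneg hS0 hT0)) (mul_le_mul_of_nonneg_right hc2 hFO0)
    _ = (exp 4 / 2 * cr) * (exp 2 * cc) ^ (2 * q + 1) * (FO + S + T) := by ring

/-- **THE SAME DIVIDED BY AN OUTPUT UNIT `(u, Kc)`** (any `u, Kc > 0`), for a track-blind majorant in the kit's product form `N m = (ε·Kc)·(u^m·μ m)` with a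
DIMENSIONLESS array `μ ≥ 0`, `μ 0 = 0`: the kit guard and the right side in the dimensionless parameters `Φ̂ = (eα/κ²)·(ε·Kc)`, `ψ̂ = ψ/u`, `τ·u`, `κ²·u`. -/
theorem klTowerBornWtFull_le_kit_units {β : ℝ} (hβ : 0 < β) (U μ : ℝ) (K : TrigPolyC4v) {d k : ℕ} (hd : 1 ≤ d) (hk : 1 ≤ k)
    (hZ : hubbardEffPartitionFnCT L M β U μ 0 K (klScale klE0 (d * k)) ≠ 0)
    {κ : ℝ} (hκ : 0 < κ)
    (hGB : IsGramBoundedR ((sectorSubMatrix L M β (bgmFatMultiplier L M klE0 β (nambuXiCT L μ K) (d * k - 1))).transpose *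
      hubbardCovSliceCT L M β μ 0 K (klScale klE0 (d * (k + 1))) (klScale klE0 (d * k)) *
        sectorSubMatrix L M β (bgmFatMultiplier L M klE0 β (nambuXiCT L μ K) (d * k - 1))) κ)
    (B : ℕ → ℕ → ℝ) (hB0 : ∀ m' Fc, 0 ≤ B m' Fc)
    (hB : ∀ (m' Fc : ℕ) (E : Finset (Fin (2 * m' + 1 + 1))) (τ : Fin (2 * m' + 1 + 1) → SectorLeg (sectorCount (d * k - 1)))
      (q : Fin (2 * m' + 1 + 1)), q ∈ E → E.card = Fc + 1 → ∀ y : SpaceTimeIdx L M,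
        imagTimeWeight β M ^ (2 * m' + 1) *
          ∑ σ ∈ univ.filter (fun σ : Fin (2 * m' + 1 + 1) → SectorLeg (sectorCount (d * k - 1)) => ∀ e ∈ E, σ e = τ e),
            ∑ x ∈ univ.filter (fun x : Fin (2 * m' + 1 + 1) → SpaceTimeIdx L M => x q = y),
              klScaleWt L M β (d * k) ((univ.image fun i => (x i, σ i)).image (latticeLegPos (2 * (2 * M)))) *
                ‖sectorisedKernel L M β (klAnisoFamily L M β μ K klE0 (d * k - 1)) (klTowerInput L M β U μ K d k) (2 * m' + 1 + 1) σ x‖ ≤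
          B (m' + 1) Fc)
    {α : ℝ} (hα : 0 < α)
    (hrow : ∀ X, ∑ Y, ‖((sectorSubMatrix L M β (bgmFatMultiplier L M klE0 β (nambuXiCT L μ K) (d * k - 1))).transpose *
        hubbardCovSliceCT L M β μ 0 K (klScale klE0 (d * (k + 1))) (klScale klE0 (d * k)) *
          sectorSubMatrix L M β (bgmFatMultiplier L M klE0 β (nambuXiCT L μ K) (d * k - 1))) X Y‖ *
        klScaleWt L M β (d * k) {latticeLegPos (2 * (2 * M)) X, latticeLegPos (2 * (2 * M)) Y} ≤ α)
    (hcol : ∀ Y, ∑ X, ‖((sectorSubMatrix L M β (bgmFatMultiplier L M klE0 β (nambuXiCT L μ K) (d * k - 1))).transpose *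
        hubbardCovSliceCT L M β μ 0 K (klScale klE0 (d * (k + 1))) (klScale klE0 (d * k)) *
          sectorSubMatrix L M β (bgmFatMultiplier L M klE0 β (nambuXiCT L μ K) (d * k - 1))) X Y‖ *
        klScaleWt L M β (d * k) {latticeLegPos (2 * (2 * M)) X, latticeLegPos (2 * (2 * M)) Y} ≤ α)
    {ρ : ℝ} (hρ : 0 < ρ)
    {cr cc : ℝ} (hcr0 : 0 ≤ cr) (hcc0 : 0 ≤ cc)
    (hrow' : ∀ X'', ∑ X', ‖(sectorAnalysisMatrix L M β (klAnisoFamily L M β μ K klE0 (d * k)) *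
        sectorSubMatrix L M β (bgmFatMultiplier L M klE0 β (nambuXiCT L μ K) (d * k - 1))) X'' X'‖ *
        klScaleWt L M β (d * k) {latticeLegPos (2 * (2 * M)) X'', latticeLegPos (2 * (2 * M)) X'} ≤ cr)
    (hcol' : ∀ X', ∑ X'', ‖(sectorAnalysisMatrix L M β (klAnisoFamily L M β μ K klE0 (d * k)) *
        sectorSubMatrix L M β (bgmFatMultiplier L M klE0 β (nambuXiCT L μ K) (d * k - 1))) X'' X'‖ *
        klScaleWt L M β (d * k) {latticeLegPos (2 * (2 * M)) X'', latticeLegPos (2 * (2 * M)) X'} ≤ cc)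
    {N₀ : ℕ} (hN₀ : 2 ≤ N₀)
    {u Kc : ℝ} (hu : 0 < u) (hKc : 0 < Kc) {μd : ℕ → ℝ} (hμ0 : ∀ m, 0 ≤ μd m) (hμ00 : μd 0 = 0)
    (hNB : ∀ m c, (27 : ℝ) ^ c * (imagTimeWeight β M * B m c) ≤ (imagTimeWeight β M * Kc) * (u ^ m * μd m))
    {D : ℕ} (hD : Fintype.card (SpaceTimeIdx L M × SectorLeg (sectorCount (d * k - 1))) / 2 ≤ D)
    {τ ψ : ℝ} (hτ1 : (exp 3 * κ) ^ 2 ≤ τ) (hτ2 : (exp 2 * (κ + ρ)) ^ 2 ≤ τ) (hψ1 : κ⁻¹ ^ 2 ≤ ψ) (hψ2 : ρ⁻¹ ^ 2 ≤ ψ)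
    (hguard : exp 1 * α / κ ^ 2 * (imagTimeWeight β M * Kc) * towerV D (τ * u) μd < 1) (q : ℕ) :
    klTowerBornWtFull L M β U μ K d k (2 * (q + 1)) ≤
      (imagTimeWeight β M * (exp 4 / 2 * cr)) * (imagTimeWeight β M * (exp 2 * cc)) ^ (2 * q + 1) * (u ^ (q + 1) * Kc) *
        (towerFO D (κ ^ 2 * u) μd (q + 1) +
          ∑ n ∈ Icc 2 (N₀ - 1), exp 1 * (exp 1 * α / κ ^ 2 * (imagTimeWeight β M * Kc)) ^ (n - 1) * (ψ / u) ^ (q + 1) * towerS D (τ * u) μd n (q + 1) +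
          (ψ / u) ^ (q + 1) * exp 1 * towerV D (τ * u) μd * (exp 1 * α / κ ^ 2 * (imagTimeWeight β M * Kc) * towerV D (τ * u) μd) ^ (N₀ - 1) /
            (1 - exp 1 * α / κ ^ 2 * (imagTimeWeight β M * Kc) * towerV D (τ * u) μd)) := by
  have hε : 0 < imagTimeWeight β M := imagTimeWeight_pos_of_pos (M := M) hβ
  -- the majorant in product form
  have hN0 : ∀ m, 0 ≤ (imagTimeWeight β M * Kc) * (u ^ m * μd m) := fun m => by have := hμ0 m; positivity
  have hN00 : (imagTimeWeight β M * Kc) * (u ^ 0 * μd 0) = 0 := by rw [hμ00]; ring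
  have hV : towerV D τ (fun m => (imagTimeWeight β M * Kc) * (u ^ m * μd m)) = (imagTimeWeight β M * Kc) * towerV D (τ * u) μd :=
    towerV_units D τ _ u μd
  have hguard' : exp 1 * α / κ ^ 2 * towerV D τ (fun m => (imagTimeWeight β M * Kc) * (u ^ m * μd m)) < 1 := by
    rw [hV, ← mul_assoc]; exact hguard
  have h := klTowerBornWtFull_le_kit' (L := L) (M := M) hβ U μ K hd hk hZ hκ hGB B hB0 hB hα hrow hcol hρ hcr0 hcc0 hrow' hcol' hN₀
    (N := fun m => (imagTimeWeight β M * Kc) * (u ^ m * μd m)) hN0 hN00 hNB hD hτ1 hτ2 hψ1 hψ2 hguard' q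
  have hk := kitStep_abs_eq_units_mul (K := imagTimeWeight β M * Kc) (u := u) (mul_ne_zero hε.ne' hKc.ne') hu.ne' D (κ ^ 2) τ
    (exp 1 * α / κ ^ 2) ψ μd (N₀ - 1) (q + 1)
  refine h.trans (le_of_eq ?_)
  rw [show ψ ^ (q + 1) * (exp 1 * towerV D τ (fun m => imagTimeWeight β M * Kc * (u ^ m * μd m)) *
        (exp 1 * α / κ ^ 2 * towerV D τ (fun m => imagTimeWeight β M * Kc * (u ^ m * μd m))) ^ (N₀ - 1) /
        (1 - exp 1 * α / κ ^ 2 * towerV D τ (fun m => imagTimeWeight β M * Kc * (u ^ m * μd m)))) =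
      ψ ^ (q + 1) * exp 1 * towerV D τ (fun m => imagTimeWeight β M * Kc * (u ^ m * μd m)) *
        (exp 1 * α / κ ^ 2 * towerV D τ (fun m => imagTimeWeight β M * Kc * (u ^ m * μd m))) ^ (N₀ - 1) /
        (1 - exp 1 * α / κ ^ 2 * towerV D τ (fun m => imagTimeWeight β M * Kc * (u ^ m * μd m))) by ring, hk]
  ring


end Summit.HubbardSuperconductivity.HubbardSuperconductivity.Theorems.EngineV8

end
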